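import Summits.ResolutionOfSingularities.ResolutionOfSingularities.Theorems.FrobeniusLadderFInjectiveMacaulayficationMonomialPBasis
import Mathlib.Data.Fin.VecNotation
import Mathlib.Tactic.FinCases
import HarnessLib

/-!
# The `K²`-basis of the P2d4C fraction field in BLOCK FORM `Fin 8 ⊕ Fin 8` (x-parity × subsets of `{y,u,t}` in the order `∅,y,u,t,yu,yt,ut,yut`)
# and the square-spanning of `F_*A₀` by the 32 generators `(m_ν, m_ν z | x m_ν, x m_ν z)`
# (crux `FInjectiveMacaulayfication` stmt-ResolutionOfSingularities-15315, chain w45a; LEMMA N♭ Tier-2 piece (B4) = the bridge from (B) `…MonomialPBasis`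
# to the hypotheses `β / hβ0 / hβ1 / hg` of res-L1-w45a-lead-1 g8's `LemmaNAssembly.isFrobeniusNormIdeal_pow_eight` at `R = A₀`; seat res-L1-w45a-stub-1 g10)

[OURS · L1 W4.5a] Support file (`--supports stmt-ResolutionOfSingularities-15315 --as helper`); replaces the role of NO printed item; NOT a
statement of any manuscript; def-free, unconditional; AI-written (AI review is weaker than expert review).

`A₀ = k[X₀..X₄]/(f)`, `f = X₄² + X₀⁴X₄ + X₁³ + X₂³ + X₃³`, `x,y,u,t,z` the classes of `X 0, …, X 4` (taken as variables with defining equations, so a consumer's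
`set` names are accepted verbatim), `m = ![1, y, u, t, y*u, y*t, u*t, y*u*t]`.
* `two_eq_zero`, `relation` (`z² + x⁴z + (y³+u³+t³) = 0`), `x_ne_zero`, `z_ne_zero` — the scalar binders of the generic assembly;
* `prod_pow_table₀/₁` — the 16 square-free monomials `∏ᵢ x̄ᵢ^{aᵢ}` along the table `Fin 8 ⊕ Fin 8 → (Fin 4 → Fin 2)` are `m_ν` and `x·m_ν`;
* ★ `exists_blockBasis` (`k` perfect, char 2; ANY fraction field `K` with `ExpChar K 2`): `∃ β : Module.Basis (Fin 8 ⊕ Fin 8) (iterateFrobeniusRange K 2 1) K`,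
  `β (inl ν) = m_ν`, `β (inr ν) = x·m_ν` in `K` (= `MonomialPBasis.exists_monomialBasis` re-indexed along the table, which is a bijection by `decide` + counting);
* ★ `exists_eq_sum_sq_blockGenerators` (`k` perfect): every `w ∈ A₀` is `Σ_j c_j ^ 2 ^ 1 · g_j` over `g = ((m_ν)_ν, (m_ν z)_ν | (x m_ν)_ν, (x m_ν z)_ν)` indexed by
  `(Fin 8 ⊕ Fin 8) ⊕ (Fin 8 ⊕ Fin 8)` (= `MonomialPBasis.exists_eq_sum_sq_add_sum_sq` re-summed along the table).
[folklore bookkeeping]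
-/

-- single-problem summit: the doubled namespace component is forced
set_option linter.dupNamespace false

namespace Summit.ResolutionOfSingularities.ResolutionOfSingularities.Theorems.FInjectiveMacaulayfication.MonomialPBasisBlockForm

open MvPolynomial Literature.AlgebraicGeometry.Resolution
open Summit.ResolutionOfSingularities.ResolutionOfSingularities.Theorems.FInjectiveMacaulayfication.MonomialPBasis

variable (k : Type*) [Field k] [CharP k 2] (f : MvPolynomial (Fin 5) k)
  (hf : f = X 4 ^ 2 + X 0 ^ 4 * X 4 + X 1 ^ 3 + X 2 ^ 3 + X 3 ^ 3)
  (x y u t z : MvPolynomial (Fin 5) k ⧸ Ideal.span {f})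
  (hx : x = Ideal.Quotient.mk (Ideal.span {f}) (X 0)) (hy : y = Ideal.Quotient.mk (Ideal.span {f}) (X 1))
  (hu : u = Ideal.Quotient.mk (Ideal.span {f}) (X 2)) (ht : t = Ideal.Quotient.mk (Ideal.span {f}) (X 3))
  (hz : z = Ideal.Quotient.mk (Ideal.span {f}) (X 4))

/-! ## §1 The scalar binders -/

omit [CharP k 2] in
include hf hx hy hu ht hz in
/-- `f̄ = 0` in `A₀`, written as `z² + x⁴z + (y³ + u³ + t³) = 0`. [plumbing] -/
theorem relation : z ^ 2 + x ^ 4 * z + (y ^ 3 + u ^ 3 + t ^ 3) = 0 := by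
  subst hx hy hu ht hz
  have hrel : Ideal.Quotient.mk (Ideal.span {f}) (X 4 ^ 2 + X 0 ^ 4 * X 4 + X 1 ^ 3 + X 2 ^ 3 + X 3 ^ 3) = 0 := by
    rw [← hf]
    exact Ideal.Quotient.eq_zero_iff_mem.mpr (Ideal.mem_span_singleton_self f)
  simp only [map_add, map_mul, map_pow] at hrel
  linear_combination hrel

/-- `2 = 0` in `A₀`. [plumbing] -/
theorem two_eq_zero : (2 : MvPolynomial (Fin 5) k ⧸ Ideal.span {f}) = 0 := by
  rw [← map_ofNat (Ideal.Quotient.mk (Ideal.span {f})) 2, CharTwo.two_eq_zero, map_zero]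

omit [CharP k 2] in
include hf hx in
/-- `x ≠ 0` in `A₀`. [plumbing] -/
theorem x_ne_zero : x ≠ 0 := by
  subst hx
  exact mk_X_castSucc_ne_zero k f hf 0

omit [CharP k 2] in
include hf hz in
/-- `z ≠ 0` in `A₀` (normal form with `r = 0`, `s = 1`). [plumbing] -/
theorem z_ne_zero : z ≠ 0 := by
  subst hz
  intro h0
  have h := normalForm_eq_zero k f hf 0 1 (by rw [map_zero, map_zero, zero_add, map_one, map_one, one_mul]; exact h0)
  exact one_ne_zero h.2

/-! ## §2 The table `Fin 8 ⊕ Fin 8 → (Fin 4 → Fin 2)` and the values of the monomials along it -/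

omit [CharP k 2] in
include hy hu ht in
/-- Parity-0 half of the table: `∏ᵢ x̄ᵢ^{aᵢ}` at the rows `(0 | subset of {y,u,t})` is `m_ν`. [by inspection] -/
theorem prod_pow_table₀ (ν : Fin 8) :
    (∏ i : Fin 4, Ideal.Quotient.mk (Ideal.span {f}) (X (Fin.castSucc i)) ^
        (((![![0, 0, 0, 0], ![0, 1, 0, 0], ![0, 0, 1, 0], ![0, 0, 0, 1], ![0, 1, 1, 0], ![0, 1, 0, 1], ![0, 0, 1, 1], ![0, 1, 1, 1]] :
          Fin 8 → Fin 4 → Fin 2) ν i : Fin 2) : ℕ)) =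
      ![1, y, u, t, y * u, y * t, u * t, y * u * t] ν := by
  subst hy hu ht
  have c1 : (Fin.castSucc (1 : Fin 4) : Fin 5) = 1 := rfl
  have c2 : (Fin.castSucc (2 : Fin 4) : Fin 5) = 2 := rfl
  have c3 : (Fin.castSucc (3 : Fin 4) : Fin 5) = 3 := rfl
  fin_cases ν <;> simp [Fin.prod_univ_four, c1, c2, c3]

omit [CharP k 2] in
include hx hy hu ht in
/-- Parity-1 half of the table: `∏ᵢ x̄ᵢ^{aᵢ}` at the rows `(1 | subset of {y,u,t})` is `x·m_ν`. [by inspection] -/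
theorem prod_pow_table₁ (ν : Fin 8) :
    (∏ i : Fin 4, Ideal.Quotient.mk (Ideal.span {f}) (X (Fin.castSucc i)) ^
        (((![![1, 0, 0, 0], ![1, 1, 0, 0], ![1, 0, 1, 0], ![1, 0, 0, 1], ![1, 1, 1, 0], ![1, 1, 0, 1], ![1, 0, 1, 1], ![1, 1, 1, 1]] :
          Fin 8 → Fin 4 → Fin 2) ν i : Fin 2) : ℕ)) =
      x * ![1, y, u, t, y * u, y * t, u * t, y * u * t] ν := by
  subst hx hy hu ht
  have c0 : (Fin.castSucc (0 : Fin 4) : Fin 5) = 0 := rfl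
  have c1 : (Fin.castSucc (1 : Fin 4) : Fin 5) = 1 := rfl
  have c2 : (Fin.castSucc (2 : Fin 4) : Fin 5) = 2 := rfl
  have c3 : (Fin.castSucc (3 : Fin 4) : Fin 5) = 3 := rfl
  fin_cases ν <;> simp [Fin.prod_univ_four, c0, c1, c2, c3] <;> ring

/-- The table is a bijection `Fin 8 ⊕ Fin 8 ≃ (Fin 4 → Fin 2)` (injective by `decide`, both sides have 16 elements). [by inspection] -/
theorem table_bijective :
    Function.Bijective (Sum.elim
      (![![0, 0, 0, 0], ![0, 1, 0, 0], ![0, 0, 1, 0], ![0, 0, 0, 1], ![0, 1, 1, 0], ![0, 1, 0, 1], ![0, 0, 1, 1], ![0, 1, 1, 1]] :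
        Fin 8 → Fin 4 → Fin 2)
      (![![1, 0, 0, 0], ![1, 1, 0, 0], ![1, 0, 1, 0], ![1, 0, 0, 1], ![1, 1, 1, 0], ![1, 1, 0, 1], ![1, 0, 1, 1], ![1, 1, 1, 1]] :
        Fin 8 → Fin 4 → Fin 2)) := by
  refine (Fintype.bijective_iff_injective_and_card _).mpr ⟨by decide, by simp⟩

/-! ## §3 The block basis and the block generators -/

variable (K : Type*) [Field K] [Algebra (MvPolynomial (Fin 5) k ⧸ Ideal.span {f}) K]
  [IsFractionRing (MvPolynomial (Fin 5) k ⧸ Ideal.span {f}) K] [ExpChar K 2]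

include hf hx hy hu ht in
/-- ★ **The `K²`-basis in block form** (`k` perfect of characteristic 2, `K` any fraction field of `A₀`): a basis `β` of `K` over `K²` indexed by `Fin 8 ⊕ Fin 8`
with `β (inl ν) = m_ν` and `β (inr ν) = x·m_ν`, `m = (1, y, u, t, yu, yt, ut, yut)` — the hypotheses `β`, `hβ0`, `hβ1` of
`LemmaNAssembly.isFrobeniusNormIdeal_pow_eight` at `R = A₀`. [folklore; OURS bookkeeping] -/
theorem exists_blockBasis [PerfectRing k 2] :
    ∃ β : Module.Basis (Fin 8 ⊕ Fin 8) (iterateFrobeniusRange K 2 1) K,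
      (∀ ν : Fin 8, (β (Sum.inl ν) : K) =
        algebraMap (MvPolynomial (Fin 5) k ⧸ Ideal.span {f}) K (![1, y, u, t, y * u, y * t, u * t, y * u * t] ν)) ∧
      (∀ ν : Fin 8, (β (Sum.inr ν) : K) =
        algebraMap (MvPolynomial (Fin 5) k ⧸ Ideal.span {f}) K (x * ![1, y, u, t, y * u, y * t, u * t, y * u * t] ν)) := by
  obtain ⟨β, hβ⟩ := exists_monomialBasis k f hf K
  have h0 := prod_pow_table₀ k f y u t hy hu ht
  have h1 := prod_pow_table₁ k f x y u t hx hy hu ht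
  refine ⟨β.reindex (Equiv.ofBijective _ table_bijective).symm, fun ν => ?_, fun ν => ?_⟩
  · rw [Module.Basis.reindex_apply, Equiv.symm_symm, Equiv.ofBijective_apply, hβ, Sum.elim_inl, h0]
  · rw [Module.Basis.reindex_apply, Equiv.symm_symm, Equiv.ofBijective_apply, hβ, Sum.elim_inr, h1]

include hf hx hy hu ht hz in
/-- ★ **Square-spanning by the block generators** (`k` perfect of characteristic 2): every `w ∈ A₀` is `Σ_j c_j ^ 2 ^ 1 · g_j` over
`g = ((m_ν)_ν, (m_ν·z)_ν | (x·m_ν)_ν, (x·m_ν·z)_ν)` — the hypothesis `hg` of `LemmaNAssembly.isFrobeniusNormIdeal_pow_eight` at `R = A₀`. [folklore; OURS bookkeeping] -/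
theorem exists_eq_sum_sq_blockGenerators [PerfectRing k 2] (w : MvPolynomial (Fin 5) k ⧸ Ideal.span {f}) :
    ∃ c : (Fin 8 ⊕ Fin 8) ⊕ (Fin 8 ⊕ Fin 8) → MvPolynomial (Fin 5) k ⧸ Ideal.span {f}, w = ∑ j, c j ^ 2 ^ 1 *
      Sum.elim (Sum.elim (fun ν => ![1, y, u, t, y * u, y * t, u * t, y * u * t] ν)
          (fun ν => ![1, y, u, t, y * u, y * t, u * t, y * u * t] ν * z))
        (Sum.elim (fun ν => x * ![1, y, u, t, y * u, y * t, u * t, y * u * t] ν)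
          (fun ν => x * ![1, y, u, t, y * u, y * t, u * t, y * u * t] ν * z)) j := by
  obtain ⟨c, d, hw⟩ := exists_eq_sum_sq_add_sum_sq k f hf w
  have h0 := prod_pow_table₀ k f y u t hy hu ht
  have h1 := prod_pow_table₁ k f x y u t hx hy hu ht
  set T₀ : Fin 8 → Fin 4 → Fin 2 :=
    ![![0, 0, 0, 0], ![0, 1, 0, 0], ![0, 0, 1, 0], ![0, 0, 0, 1], ![0, 1, 1, 0], ![0, 1, 0, 1], ![0, 0, 1, 1], ![0, 1, 1, 1]] with hT₀
  set T₁ : Fin 8 → Fin 4 → Fin 2 :=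
    ![![1, 0, 0, 0], ![1, 1, 0, 0], ![1, 0, 1, 0], ![1, 0, 0, 1], ![1, 1, 1, 0], ![1, 1, 0, 1], ![1, 0, 1, 1], ![1, 1, 1, 1]] with hT₁
  have hbij : Function.Bijective (Sum.elim T₀ T₁) := table_bijective
  refine ⟨Sum.elim (Sum.elim (fun ν => c (T₀ ν)) (fun ν => d (T₀ ν))) (Sum.elim (fun ν => c (T₁ ν)) (fun ν => d (T₁ ν))), ?_⟩
  subst hz
  -- re-sum the two `(Fin 4 → Fin 2)`-sums along the table
  have hc : ∑ a : Fin 4 → Fin 2, c a ^ 2 * ∏ i, Ideal.Quotient.mk (Ideal.span {f}) (X (Fin.castSucc i)) ^ (a i : ℕ) =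
      ∑ ν : Fin 8, c (T₀ ν) ^ 2 * ![1, y, u, t, y * u, y * t, u * t, y * u * t] ν +
        ∑ ν : Fin 8, c (T₁ ν) ^ 2 * (x * ![1, y, u, t, y * u, y * t, u * t, y * u * t] ν) := by
    rw [← Fintype.sum_bijective _ hbij (fun j => c (Sum.elim T₀ T₁ j) ^ 2 *
      ∏ i, Ideal.Quotient.mk (Ideal.span {f}) (X (Fin.castSucc i)) ^ ((Sum.elim T₀ T₁ j) i : ℕ)) _ (fun _ => rfl), Fintype.sum_sum_type]
    simp only [Sum.elim_inl, Sum.elim_inr, h0, h1]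
  have hd : ∑ a : Fin 4 → Fin 2, d a ^ 2 * ((∏ i, Ideal.Quotient.mk (Ideal.span {f}) (X (Fin.castSucc i)) ^ (a i : ℕ)) *
      Ideal.Quotient.mk (Ideal.span {f}) (X 4)) =
      ∑ ν : Fin 8, d (T₀ ν) ^ 2 * (![1, y, u, t, y * u, y * t, u * t, y * u * t] ν * Ideal.Quotient.mk (Ideal.span {f}) (X 4)) +
        ∑ ν : Fin 8, d (T₁ ν) ^ 2 * (x * ![1, y, u, t, y * u, y * t, u * t, y * u * t] ν * Ideal.Quotient.mk (Ideal.span {f}) (X 4)) := by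
    rw [← Fintype.sum_bijective _ hbij (fun j => d (Sum.elim T₀ T₁ j) ^ 2 *
      ((∏ i, Ideal.Quotient.mk (Ideal.span {f}) (X (Fin.castSucc i)) ^ ((Sum.elim T₀ T₁ j) i : ℕ)) * Ideal.Quotient.mk (Ideal.span {f}) (X 4)))
      _ (fun _ => rfl), Fintype.sum_sum_type]
    simp only [Sum.elim_inl, Sum.elim_inr, h0, h1]
  rw [hw, hc, hd]
  simp only [Fintype.sum_sum_type, Sum.elim_inl, Sum.elim_inr, pow_one]
  abel

end Summit.ResolutionOfSingularities.ResolutionOfSingularities.Theorems.FInjectiveMacaulayfication.MonomialPBasisBlockForm
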